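import Mathlib.Analysis.SpecialFunctions.Trigonometric.ArctanDeriv
import Mathlib.Analysis.SpecialFunctions.Log.Deriv
import Mathlib.Analysis.Complex.Exponential
import Mathlib.Analysis.Complex.ExponentialBounds
import Mathlib.Analysis.Calculus.Deriv.MeanValue
import HarnessLib

/-!
# Kernel-evaluable rational enclosures of `arctan`, `exp`, `log (1 + ·)` with dyadic directed rounding

Topic `Analysis/Quadrature`. Written for the hubbard-tc cell (MO-S3 `T_c` back-end, seat mod-2, 2026-08-27) as the arithmetic
layer of a KERNEL-CHECKED Brillouin-zone quadrature (`CosineHatMajorant`, `FreeFermionPressureQuadrature`): every function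
below is a closed rational term that `decide +kernel` evaluates, and every theorem says which real number it encloses.

* §1 `rup` / `rdn`: rounding to the dyadic grid `2⁻⁶⁰ℤ` (keeps numerators small inside long kernel computations),
  `le_rup`, `rdn_le`.
* §2 `arctan`: the alternating-series brackets `z - z³/3 + z⁵/5 - z⁷/7 ≤ arctan z ≤ z - z³/3 + z⁵/5` (`z ≥ 0`, proved from
  the sign of the derivative), and the tables `atanLo N j ≤ 2·arctan (j/N) ≤ atanHi N j` built by the addition formula
  `arctan ((j+1)/N) = arctan (j/N) + arctan (N / (N² + j(j+1)))` (small arguments only, so the brackets are tight).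
* §3 `exp`: `expTaylorAux` (partial sums), `expPos` (five halvings, 12 Taylor terms with the `Real.exp_bound` remainder,
  five squarings), `expEncl` (either sign, `|y| ≤ 32`), with `expEncl_le_exp` / `exp_le_expEncl`.
* §4 `log (1 + e)`, `0 ≤ e ≤ 1`: odd alternating partial sums are UPPER bounds (`log_one_add_le_logAlt`), the tail form
  `log (1 - y) ≤ -(y + … + y⁵/5)`, and the combined `log1pUpper` with `log_one_add_le_log1pUpper`.

Everything is PROVED (standard axioms); no definition of mathematical content beyond the computable bracket functions, no
named fact. HONEST FRAMING: elementary real analysis in service of certified numerics; no physics here.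

References: Abramowitz–Stegun 4.4.42 (arctan series), 4.1.24 (log series), 4.2.1 (exp series), 4.4.34 (addition formula)
[cite: AbramowitzStegun1964, 4.4.42]; Davis–Rabinowitz §4.2 (interval / directed-rounding evaluation of rules)
[cite: DavisRabinowitz1984, Sect. 4.2].
-/

namespace Literature.Analysis.Quadrature

namespace KernelQuadrature

open Real Finset

/-! ### §1 Dyadic directed rounding -/

/-- The dyadic scale `2⁶⁰`. [folklore] -/
def dy : ℚ := 1152921504606846976

/-- Round UP to the grid `2⁻⁶⁰ℤ`. [folklore] -/
def rup (q : ℚ) : ℚ := (⌈q * dy⌉ : ℚ) / dy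

/-- Round DOWN to the grid `2⁻⁶⁰ℤ`. [folklore] -/
def rdn (q : ℚ) : ℚ := (⌊q * dy⌋ : ℚ) / dy

/-- `0 < 2⁶⁰`. [folklore] -/
private theorem dy_pos : (0 : ℚ) < dy := by unfold dy; norm_num

/-- `q ≤ rup q` (directed rounding). [cite: DavisRabinowitz1984, Sect. 4.2] -/
theorem le_rup (q : ℚ) : q ≤ rup q := by
  unfold rup
  rw [le_div_iff₀ dy_pos]
  exact Int.le_ceil _

/-- `rdn q ≤ q` (directed rounding). [cite: DavisRabinowitz1984, Sect. 4.2] -/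
theorem rdn_le (q : ℚ) : rdn q ≤ q := by
  unfold rdn
  rw [div_le_iff₀ dy_pos]
  exact Int.floor_le _

/-- Real form of `le_rup`. [cite: DavisRabinowitz1984, Sect. 4.2] -/
theorem cast_le_rup {x : ℝ} {q : ℚ} (h : x ≤ q) : x ≤ ((rup q : ℚ) : ℝ) :=
  h.trans (by exact_mod_cast le_rup q)

/-- Real form of `rdn_le`. [cite: DavisRabinowitz1984, Sect. 4.2] -/
theorem rdn_cast_le {x : ℝ} {q : ℚ} (h : (q : ℝ) ≤ x) : ((rdn q : ℚ) : ℝ) ≤ x :=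
  le_trans (by exact_mod_cast rdn_le q) h

/-! ### §2 `arctan` brackets and the `2·arctan (j/N)` tables -/

/-- Lower bracket polynomial `z - z³/3 + z⁵/5 - z⁷/7`. [cite: AbramowitzStegun1964, 4.4.42] -/
def P7 (z : ℚ) : ℚ := z - z ^ 3 / 3 + z ^ 5 / 5 - z ^ 7 / 7

/-- Upper bracket polynomial `z - z³/3 + z⁵/5`. [cite: AbramowitzStegun1964, 4.4.42] -/
def P5 (z : ℚ) : ℚ := z - z ^ 3 / 3 + z ^ 5 / 5

/-- **`z - z³/3 + z⁵/5 - z⁷/7 ≤ arctan z` for `z ≥ 0`** (the derivative of the difference is `z⁸/(1+z²) ≥ 0`).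
[cite: AbramowitzStegun1964, 4.4.42] -/
theorem P7_le_arctan {z : ℝ} (hz : 0 ≤ z) : z - z ^ 3 / 3 + z ^ 5 / 5 - z ^ 7 / 7 ≤ arctan z := by
  let f : ℝ → ℝ := fun x => arctan x - (x - x ^ 3 / 3 + x ^ 5 / 5 - x ^ 7 / 7)
  have hd : ∀ x, HasDerivAt f (1 / (1 + x ^ 2) - (1 - 3 * x ^ 2 / 3 + 5 * x ^ 4 / 5 - 7 * x ^ 6 / 7)) x := by
    intro x
    have h1 := Real.hasDerivAt_arctan x
    have h2 : HasDerivAt (fun x : ℝ => x - x ^ 3 / 3 + x ^ 5 / 5 - x ^ 7 / 7)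
        (1 - 3 * x ^ 2 / 3 + 5 * x ^ 4 / 5 - 7 * x ^ 6 / 7) x := by
      have h := (((hasDerivAt_id x).sub ((hasDerivAt_pow 3 x).div_const 3)).add
        ((hasDerivAt_pow 5 x).div_const 5)).sub ((hasDerivAt_pow 7 x).div_const 7)
      refine h.congr_deriv ?_
      push_cast
      ring
    exact h1.sub h2
  have hmono : MonotoneOn f (Set.Ici 0) := by
    refine monotoneOn_of_deriv_nonneg (convex_Ici 0) ?_ ?_ ?_
    · exact HasDerivAt.continuousOn fun x _ => hd x
    · exact fun x _ => (hd x).differentiableAt.differentiableWithinAt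
    · intro x _
      rw [(hd x).deriv]
      have h1 : (0 : ℝ) < 1 + x ^ 2 := by positivity
      have : 1 / (1 + x ^ 2) - (1 - 3 * x ^ 2 / 3 + 5 * x ^ 4 / 5 - 7 * x ^ 6 / 7) = x ^ 8 / (1 + x ^ 2) := by
        field_simp
        ring
      rw [this]
      positivity
  have h := hmono (Set.mem_Ici.2 le_rfl) (Set.mem_Ici.2 hz) hz
  simp only [f, arctan_zero] at h
  linarith

/-- **`arctan z ≤ z - z³/3 + z⁵/5` for `z ≥ 0`** (derivative of the difference `z⁶/(1+z²) ≥ 0`).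
[cite: AbramowitzStegun1964, 4.4.42] -/
theorem arctan_le_P5 {z : ℝ} (hz : 0 ≤ z) : arctan z ≤ z - z ^ 3 / 3 + z ^ 5 / 5 := by
  let f : ℝ → ℝ := fun x => (x - x ^ 3 / 3 + x ^ 5 / 5) - arctan x
  have hd : ∀ x, HasDerivAt f ((1 - 3 * x ^ 2 / 3 + 5 * x ^ 4 / 5) - 1 / (1 + x ^ 2)) x := by
    intro x
    have h1 := Real.hasDerivAt_arctan x
    have h2 : HasDerivAt (fun x : ℝ => x - x ^ 3 / 3 + x ^ 5 / 5) (1 - 3 * x ^ 2 / 3 + 5 * x ^ 4 / 5) x := by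
      have h := ((hasDerivAt_id x).sub ((hasDerivAt_pow 3 x).div_const 3)).add ((hasDerivAt_pow 5 x).div_const 5)
      refine h.congr_deriv ?_
      push_cast
      ring
    exact h2.sub h1
  have hmono : MonotoneOn f (Set.Ici 0) := by
    refine monotoneOn_of_deriv_nonneg (convex_Ici 0) ?_ ?_ ?_
    · exact HasDerivAt.continuousOn fun x _ => hd x
    · exact fun x _ => (hd x).differentiableAt.differentiableWithinAt
    · intro x _
      rw [(hd x).deriv]
      have h1 : (0 : ℝ) < 1 + x ^ 2 := by positivity
      have : (1 - 3 * x ^ 2 / 3 + 5 * x ^ 4 / 5) - 1 / (1 + x ^ 2) = x ^ 6 / (1 + x ^ 2) := by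
        field_simp
        ring
      rw [this]
      positivity
  have h := hmono (Set.mem_Ici.2 le_rfl) (Set.mem_Ici.2 hz) hz
  simp only [f, arctan_zero] at h
  linarith

/-- The addition-formula step `N / (N² + j(j+1))`: `arctan ((j+1)/N) = arctan (j/N) + arctan (zStep N j)`.
[cite: AbramowitzStegun1964, 4.4.34] -/
def zStep (N j : ℕ) : ℚ := (N : ℚ) / ((N : ℚ) * N + (j : ℚ) * (j + 1))

/-- Lower table: `atanLo N j ≤ 2·arctan (j/N)` (`j ≤ N`). [cite: AbramowitzStegun1964, 4.4.34] -/
def atanLo (N : ℕ) : ℕ → ℚ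
  | 0 => 0
  | j + 1 => rdn (atanLo N j + 2 * P7 (zStep N j))

/-- Upper table: `2·arctan (j/N) ≤ atanHi N j` (`j ≤ N`). [cite: AbramowitzStegun1964, 4.4.34] -/
def atanHi (N : ℕ) : ℕ → ℚ
  | 0 => 0
  | j + 1 => rup (atanHi N j + 2 * P5 (zStep N j))

/-- **The addition formula along the table**: for `1 ≤ N`, `j < N`,
`arctan ((j+1)/N) = arctan (j/N) + arctan (N/(N² + j(j+1)))`. [cite: AbramowitzStegun1964, 4.4.34] -/
private theorem arctan_succ_div (N j : ℕ) (hN : 1 ≤ N) (hj : j < N) :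
    arctan (((j : ℝ) + 1) / N) = arctan ((j : ℝ) / N) + arctan ((zStep N j : ℚ) : ℝ) := by
  have hNr : (1 : ℝ) ≤ N := by exact_mod_cast hN
  have hNpos : (0 : ℝ) < N := by linarith
  have hN0 : (N : ℝ) ≠ 0 := hNpos.ne'
  have hjr : (j : ℝ) < N := by exact_mod_cast hj
  have hj0 : (0 : ℝ) ≤ j := by positivity
  have hz : ((zStep N j : ℚ) : ℝ) = (N : ℝ) / ((N : ℝ) * N + (j : ℝ) * (j + 1)) := by
    simp [zStep]
  have hden : (0 : ℝ) < (N : ℝ) * N + (j : ℝ) * (j + 1) := by positivity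
  have hD0 : (N : ℝ) * N + (j : ℝ) * (j + 1) ≠ 0 := hden.ne'
  have hE : (0 : ℝ) < (N : ℝ) * N + (j : ℝ) * j := by positivity
  have hprod : (j : ℝ) / N * (((zStep N j : ℚ) : ℝ)) < 1 := by
    rw [hz, div_mul_div_comm, div_lt_one (by positivity)]
    nlinarith
  rw [Real.arctan_add hprod]
  congr 1
  rw [hz]
  have e1 : (j : ℝ) / N + N / ((N : ℝ) * N + (j : ℝ) * (j + 1)) =
      ((j : ℝ) + 1) * ((N : ℝ) * N + j * j) / (N * ((N : ℝ) * N + (j : ℝ) * (j + 1))) := by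
    field_simp
    ring
  have e2 : 1 - (j : ℝ) / N * (N / ((N : ℝ) * N + (j : ℝ) * (j + 1))) =
      ((N : ℝ) * N + j * j) / ((N : ℝ) * N + (j : ℝ) * (j + 1)) := by
    field_simp
    ring
  have hE0 : (N : ℝ) * N + (j : ℝ) * j ≠ 0 := hE.ne'
  rw [e1, e2]
  field_simp

/-- **Table soundness**: `atanLo N j ≤ 2·arctan (j/N) ≤ atanHi N j` for `j ≤ N`, `1 ≤ N`.
[cite: AbramowitzStegun1964, 4.4.42] -/
theorem atanLo_le_and_le_atanHi (N : ℕ) (hN : 1 ≤ N) :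
    ∀ j ≤ N, ((atanLo N j : ℚ) : ℝ) ≤ 2 * arctan ((j : ℝ) / N) ∧ 2 * arctan ((j : ℝ) / N) ≤ ((atanHi N j : ℚ) : ℝ) := by
  intro j
  induction j with
  | zero => intro _; simp [atanLo, atanHi]
  | succ j ih =>
    intro hj
    have hj' : j < N := Nat.lt_of_succ_le hj
    obtain ⟨ih1, ih2⟩ := ih hj'.le
    have hstep := arctan_succ_div N j hN hj'
    have hNpos : (0 : ℝ) < N := by exact_mod_cast (Nat.lt_of_lt_of_le Nat.zero_lt_one hN)
    have hz0 : (0 : ℝ) ≤ ((zStep N j : ℚ) : ℝ) := by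
      have : ((zStep N j : ℚ) : ℝ) = (N : ℝ) / ((N : ℝ) * N + (j : ℝ) * (j + 1)) := by simp [zStep]
      rw [this]; positivity
    have hlo := P7_le_arctan hz0
    have hhi := arctan_le_P5 hz0
    have e7 : ((P7 (zStep N j) : ℚ) : ℝ) = ((zStep N j : ℚ) : ℝ) - ((zStep N j : ℚ) : ℝ) ^ 3 / 3 +
        ((zStep N j : ℚ) : ℝ) ^ 5 / 5 - ((zStep N j : ℚ) : ℝ) ^ 7 / 7 := by
      simp only [P7]; push_cast; ring
    have e5 : ((P5 (zStep N j) : ℚ) : ℝ) = ((zStep N j : ℚ) : ℝ) - ((zStep N j : ℚ) : ℝ) ^ 3 / 3 +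
        ((zStep N j : ℚ) : ℝ) ^ 5 / 5 := by
      simp only [P5]; push_cast; ring
    constructor
    · simp only [atanLo]
      apply rdn_cast_le
      push_cast
      rw [hstep, e7]
      linarith
    · simp only [atanHi]
      apply cast_le_rup
      push_cast
      rw [hstep, e5]
      linarith

/-! ### §3 `exp` enclosures -/

/-- Taylor data `expTaylorAux z n = (Σ_{m<n} z^m/m!, zⁿ/n!)`, computed iteratively. [cite: AbramowitzStegun1964, 4.2.1] -/
def expTaylorAux (z : ℚ) : ℕ → ℚ × ℚ
  | 0 => (0, 1)
  | m + 1 =>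
    match expTaylorAux z m with
    | (s, t) => (s + t, t * z / (m + 1))

/-- The iterative Taylor data are the partial sum and the next term. [folklore] -/
private theorem expTaylorAux_eq (z : ℚ) (n : ℕ) :
    expTaylorAux z n = (∑ m ∈ Finset.range n, z ^ m / m.factorial, z ^ n / n.factorial) := by
  induction n with
  | zero => simp [expTaylorAux]
  | succ n ih =>
    rw [expTaylorAux, ih]
    simp only [Prod.mk.injEq]
    refine ⟨by rw [Finset.sum_range_succ], ?_⟩
    rw [Nat.factorial_succ]
    push_cast
    have hf : ((n.factorial : ℕ) : ℚ) ≠ 0 := by exact_mod_cast n.factorial_ne_zero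
    field_simp
    ring

/-- One squaring step with directed rounding (lower end clipped at `0`). [folklore] -/
def sqStep (lh : ℚ × ℚ) : ℚ × ℚ := (rdn (max lh.1 0 * max lh.1 0), rup (lh.2 * lh.2))

/-- `sqStep` squares an enclosure of `exp x` into one of `exp (2x)`. [folklore] -/
private theorem sqStep_spec (lh : ℚ × ℚ) {x : ℝ} (h1 : ((lh.1 : ℚ) : ℝ) ≤ Real.exp x) (h2 : Real.exp x ≤ ((lh.2 : ℚ) : ℝ)) :
    (((sqStep lh).1 : ℚ) : ℝ) ≤ Real.exp (2 * x) ∧ Real.exp (2 * x) ≤ (((sqStep lh).2 : ℚ) : ℝ) := by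
  have hsq : Real.exp (2 * x) = Real.exp x * Real.exp x := by rw [two_mul, Real.exp_add]
  have hpos := Real.exp_pos x
  constructor
  · simp only [sqStep]
    apply rdn_cast_le
    push_cast
    rw [hsq]
    have hm : max ((lh.1 : ℚ) : ℝ) 0 ≤ Real.exp x := max_le h1 hpos.le
    have hm0 : 0 ≤ max ((lh.1 : ℚ) : ℝ) 0 := le_max_right _ _
    exact mul_le_mul hm hm hm0 hpos.le
  · simp only [sqStep]
    apply cast_le_rup
    push_cast
    rw [hsq]
    exact mul_le_mul h2 h2 hpos.le (hpos.le.trans h2)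

/-- **Enclosure of `exp y` for `0 ≤ y ≤ 32`**: `z = y/32 ∈ [0,1]`, 12 Taylor terms with the `Real.exp_bound` remainder
`z¹²·13/(12!·12)`, then five squarings. [cite: AbramowitzStegun1964, 4.2.1] -/
def expPos (y : ℚ) : ℚ × ℚ :=
  match expTaylorAux (y / 32) 12 with
  | (s, t) => sqStep (sqStep (sqStep (sqStep (sqStep (rdn (s - t * 13 / 12), rup (s + t * 13 / 12))))))

/-- Soundness of `expPos`. [cite: AbramowitzStegun1964, 4.2.1] -/
theorem expPos_spec (y : ℚ) (hy0 : 0 ≤ y) (hy32 : y ≤ 32) :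
    (((expPos y).1 : ℚ) : ℝ) ≤ Real.exp y ∧ Real.exp (y : ℝ) ≤ (((expPos y).2 : ℚ) : ℝ) := by
  have hT := expTaylorAux_eq (y / 32) 12
  -- the innermost enclosure of `exp (y/32)`
  set z : ℝ := (y : ℝ) / 32 with hz
  have hz0 : 0 ≤ z := by rw [hz]; exact div_nonneg (by exact_mod_cast hy0) (by norm_num)
  have hz1 : z ≤ 1 := by
    rw [hz, div_le_one (by norm_num)]; exact_mod_cast hy32
  have habs : |z| ≤ 1 := by rw [abs_of_nonneg hz0]; exact hz1
  have hb := Real.exp_bound habs (n := 12) (by norm_num)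
  rw [abs_of_nonneg hz0] at hb
  have hs : (((expTaylorAux (y / 32) 12).1 : ℚ) : ℝ) = ∑ m ∈ Finset.range 12, z ^ m / m.factorial := by
    rw [hT]; push_cast; rfl
  have ht : (((expTaylorAux (y / 32) 12).2 : ℚ) : ℝ) * 13 / 12 = z ^ 12 * ((Nat.succ 12 : ℕ) / (Nat.factorial 12 * 12)) := by
    rw [hT]; push_cast
    simp [Nat.factorial]
    rw [hz]
    ring
  have hin1 : (((rdn ((expTaylorAux (y / 32) 12).1 - (expTaylorAux (y / 32) 12).2 * 13 / 12)) : ℚ) : ℝ) ≤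
      Real.exp z := by
    apply rdn_cast_le
    push_cast
    rw [hs, mul_div_assoc, show (((expTaylorAux (y / 32) 12).2 : ℚ) : ℝ) * (13 / 12) =
      (((expTaylorAux (y / 32) 12).2 : ℚ) : ℝ) * 13 / 12 by ring, ht]
    have := (abs_sub_le_iff.1 hb).2
    linarith
  have hin2 : Real.exp z ≤
      (((rup ((expTaylorAux (y / 32) 12).1 + (expTaylorAux (y / 32) 12).2 * 13 / 12)) : ℚ) : ℝ) := by
    apply cast_le_rup
    push_cast
    rw [hs, mul_div_assoc, show (((expTaylorAux (y / 32) 12).2 : ℚ) : ℝ) * (13 / 12) =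
      (((expTaylorAux (y / 32) 12).2 : ℚ) : ℝ) * 13 / 12 by ring, ht]
    have := (abs_sub_le_iff.1 hb).1
    linarith
  -- five squarings
  have e : Real.exp (y : ℝ) = Real.exp (2 * (2 * (2 * (2 * (2 * z))))) := by rw [hz]; ring_nf
  set L0 : ℚ × ℚ := (rdn ((expTaylorAux (y / 32) 12).1 - (expTaylorAux (y / 32) 12).2 * 13 / 12),
    rup ((expTaylorAux (y / 32) 12).1 + (expTaylorAux (y / 32) 12).2 * 13 / 12)) with hL0
  have s1 := sqStep_spec L0 hin1 hin2
  have s2 := sqStep_spec (sqStep L0) s1.1 s1.2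
  have s3 := sqStep_spec (sqStep (sqStep L0)) s2.1 s2.2
  have s4 := sqStep_spec (sqStep (sqStep (sqStep L0))) s3.1 s3.2
  have s5 := sqStep_spec (sqStep (sqStep (sqStep (sqStep L0)))) s4.1 s4.2
  have hexp : expPos y = sqStep (sqStep (sqStep (sqStep (sqStep L0)))) := by
    unfold expPos
    rw [hL0]
  rw [e, hexp]
  exact s5

/-- **Enclosure of `exp y`, `|y| ≤ 32`**: `expPos` for `y ≥ 0`, reciprocals for `y < 0`. [cite: AbramowitzStegun1964, 4.2.1] -/
def expEncl (y : ℚ) : ℚ × ℚ :=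
  if 0 ≤ y then expPos y else
    match expPos (-y) with
    | (a, b) => (rdn (1 / b), rup (1 / a))

/-- Soundness of `expEncl` (the reciprocal branch needs the checked positivity of the lower end). [cite: AbramowitzStegun1964, 4.2.1] -/
theorem expEncl_spec (y : ℚ) (hy : |y| ≤ 32) (hpos : 0 < (expPos |y|).1) :
    (((expEncl y).1 : ℚ) : ℝ) ≤ Real.exp y ∧ Real.exp (y : ℝ) ≤ (((expEncl y).2 : ℚ) : ℝ) := by
  unfold expEncl
  by_cases h0 : 0 ≤ y
  · rw [if_pos h0]
    rw [abs_of_nonneg h0] at hy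
    exact expPos_spec y h0 hy
  · rw [if_neg h0]
    have hyneg : y < 0 := lt_of_not_ge h0
    have habs : |y| = -y := abs_of_neg hyneg
    rw [habs] at hy hpos
    have hsp := expPos_spec (-y) (by linarith) hy
    push_cast at hsp
    have hexp : Real.exp (y : ℝ) = 1 / Real.exp (-(y : ℝ)) := by
      rw [Real.exp_neg]; simp
    have hlo_pos : (0 : ℝ) < (((expPos (-y)).1 : ℚ) : ℝ) := by exact_mod_cast hpos
    have hepos := Real.exp_pos (-(y : ℝ))
    constructor
    · apply rdn_cast_le
      push_cast
      rw [hexp]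
      exact one_div_le_one_div_of_le hepos hsp.2
    · apply cast_le_rup
      push_cast
      rw [hexp]
      exact one_div_le_one_div_of_le hlo_pos hsp.1

/-! ### §4 Upper bounds for `log (1 + e)`, `0 ≤ e ≤ 1` -/

/-- Alternating partial sums `logAltAux E n = (Σ_{i<n} (-1)^i E^{i+1}/(i+1), Eⁿ)`. [cite: AbramowitzStegun1964, 4.1.24] -/
def logAltAux (E : ℚ) : ℕ → ℚ × ℚ
  | 0 => (0, 1)
  | i + 1 =>
    match logAltAux E i with
    | (s, p) => (s + (-1) ^ i * (p * E) / (i + 1), p * E)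

/-- `logAlt E n = Σ_{i<n} (-1)^i E^{i+1}/(i+1)`. [cite: AbramowitzStegun1964, 4.1.24] -/
def logAlt (E : ℚ) (n : ℕ) : ℚ := (logAltAux E n).1

/-- The iterative data are the partial sum and the power. [folklore] -/
private theorem logAltAux_eq (E : ℚ) (n : ℕ) :
    logAltAux E n = (∑ i ∈ Finset.range n, (-1) ^ i * E ^ (i + 1) / (i + 1), E ^ n) := by
  induction n with
  | zero => simp [logAltAux]
  | succ n ih =>
    rw [logAltAux, ih]
    simp only [Prod.mk.injEq]
    exact ⟨by rw [Finset.sum_range_succ, pow_succ], by rw [pow_succ]⟩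

/-- **Odd alternating partial sums bound `log (1+e)` from above** (`e ≥ 0`): the derivative of
`Σ_{i<2m+1} (-1)^i e^{i+1}/(i+1) - log (1+e)` is `e^{2m+1}/(1+e) ≥ 0`. [cite: AbramowitzStegun1964, 4.1.24] -/
theorem log_one_add_le_altSum {e : ℝ} (he : 0 ≤ e) (m : ℕ) :
    Real.log (1 + e) ≤ ∑ i ∈ Finset.range (2 * m + 1), (-1) ^ i * e ^ (i + 1) / (i + 1) := by
  set n := 2 * m + 1 with hn
  let F : ℝ → ℝ := fun x => (∑ i ∈ Finset.range n, (-1) ^ i * x ^ (i + 1) / (i + 1)) - Real.log (1 + x)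
  have hd : ∀ x, 0 ≤ x → HasDerivAt F ((∑ i ∈ Finset.range n, (-1) ^ i * x ^ i) - 1 / (1 + x)) x := by
    intro x hx
    have h1 : HasDerivAt (fun x => ∑ i ∈ Finset.range n, (-1 : ℝ) ^ i * x ^ (i + 1) / (i + 1))
        (∑ i ∈ Finset.range n, (-1 : ℝ) ^ i * x ^ i) x := by
      refine HasDerivAt.fun_sum (u := Finset.range n) (x := x)
        (A := fun i (y : ℝ) => (-1 : ℝ) ^ i * y ^ (i + 1) / ((i : ℝ) + 1))
        (A' := fun i => (-1 : ℝ) ^ i * x ^ i) fun i _ => ?_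
      have h := ((hasDerivAt_pow (i + 1) x).const_mul ((-1 : ℝ) ^ i)).div_const ((i : ℝ) + 1)
      refine h.congr_deriv ?_
      have : ((i : ℝ) + 1) ≠ 0 := by positivity
      field_simp
      push_cast
      ring
    have h2 : HasDerivAt (fun x => Real.log (1 + x)) (1 / (1 + x)) x := by
      have h0 : HasDerivAt (fun y : ℝ => 1 + y) 1 x := by
        simpa using (hasDerivAt_id x).const_add (1 : ℝ)
      have hne : (1 + x) ≠ 0 := by linarith
      exact h0.log hne
    exact h1.sub h2
  have hmono : MonotoneOn F (Set.Ici 0) := by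
    refine monotoneOn_of_deriv_nonneg (convex_Ici 0) ?_ ?_ ?_
    · exact fun x hx => (hd x hx).continuousAt.continuousWithinAt
    · intro x hx
      rw [interior_Ici] at hx
      exact (hd x (le_of_lt hx)).differentiableAt.differentiableWithinAt
    · intro x hx
      rw [interior_Ici] at hx
      have hx0 : 0 < x := hx
      rw [(hd x hx0.le).deriv]
      have hgeom : ∑ i ∈ Finset.range n, (-1 : ℝ) ^ i * x ^ i = (1 + x ^ n) / (1 + x) := by
        have hne : (-x : ℝ) ≠ 1 := by linarith
        have hg := geom_sum_eq hne n
        simp_rw [neg_pow x] at hg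
        rw [hg]
        have hodd : (-1 : ℝ) ^ n = -1 := by
          rw [hn]; exact Odd.neg_one_pow ⟨m, rfl⟩
        rw [hodd]
        have h1x : (1 + x) ≠ 0 := by linarith
        have h2x : (-x - 1) ≠ 0 := by linarith
        field_simp
        ring
      rw [hgeom]
      have h1x : 0 < 1 + x := by linarith
      rw [div_sub_div_same, add_sub_cancel_left]
      positivity
  have h := hmono (Set.mem_Ici.2 le_rfl) (Set.mem_Ici.2 he) he
  simp only [F] at h
  norm_num at h
  linarith

/-- **`log (1 - y) ≤ -(y + y²/2 + y³/3 + y⁴/4 + y⁵/5)`** for `0 ≤ y < 1` (derivative of the difference `y⁵/(1-y) ≥ 0`).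
[cite: AbramowitzStegun1964, 4.1.24] -/
theorem log_one_sub_le_poly5 {y : ℝ} (hy0 : 0 ≤ y) (hy1 : y < 1) :
    Real.log (1 - y) ≤ -(y + y ^ 2 / 2 + y ^ 3 / 3 + y ^ 4 / 4 + y ^ 5 / 5) := by
  let G : ℝ → ℝ := fun x => -Real.log (1 - x) - (x + x ^ 2 / 2 + x ^ 3 / 3 + x ^ 4 / 4 + x ^ 5 / 5)
  have hd : ∀ x, x < 1 → HasDerivAt G (1 / (1 - x) - (1 + x + x ^ 2 + x ^ 3 + x ^ 4)) x := by
    intro x hx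
    have h1 : HasDerivAt (fun x => -Real.log (1 - x)) (1 / (1 - x)) x := by
      have h0 : HasDerivAt (fun y : ℝ => 1 - y) (-1) x := by
        simpa using (hasDerivAt_id x).const_sub (1 : ℝ)
      have hne : (1 - x) ≠ 0 := by linarith
      have h := (h0.log hne).neg
      refine h.congr_deriv ?_
      rw [neg_div, neg_neg]
    have h2 : HasDerivAt (fun x : ℝ => x + x ^ 2 / 2 + x ^ 3 / 3 + x ^ 4 / 4 + x ^ 5 / 5)
        (1 + x + x ^ 2 + x ^ 3 + x ^ 4) x := by
      have h := ((((hasDerivAt_id x).add ((hasDerivAt_pow 2 x).div_const 2)).add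
        ((hasDerivAt_pow 3 x).div_const 3)).add ((hasDerivAt_pow 4 x).div_const 4)).add
        ((hasDerivAt_pow 5 x).div_const 5)
      refine h.congr_deriv ?_
      push_cast
      ring
    exact h1.sub h2
  have hmono : MonotoneOn G (Set.Ico 0 1) := by
    refine monotoneOn_of_deriv_nonneg (convex_Ico 0 1) ?_ ?_ ?_
    · exact fun x hx => (hd x hx.2).continuousAt.continuousWithinAt
    · intro x hx
      rw [interior_Ico] at hx
      exact (hd x hx.2).differentiableAt.differentiableWithinAt
    · intro x hx
      rw [interior_Ico] at hx
      rw [(hd x hx.2).deriv]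
      have h1x : 0 < 1 - x := by linarith [hx.2]
      have : 1 / (1 - x) - (1 + x + x ^ 2 + x ^ 3 + x ^ 4) = x ^ 5 / (1 - x) := by
        field_simp
        ring
      rw [this]
      exact div_nonneg (pow_nonneg hx.1.le 5) h1x.le
  have h := hmono (show (0 : ℝ) ∈ Set.Ico 0 1 by simp) ⟨hy0, hy1⟩ hy0
  simp only [G] at h
  norm_num at h
  linarith

/-- `0.6931471808`, an upper bound of `log 2` (`Real.log_two_lt_d9`). [folklore] -/
def log2Hi : ℚ := 6931471808 / 10000000000

/-- **Upper bound on `log (1 + e)` valid for every real `0 ≤ e ≤ min E 1`**: near `e = 1` the tail form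
`log 2 + log (1 - y)`, `y = (1 - min E 1)/2`; else the odd alternating sums with 21 / 9 terms. [cite: AbramowitzStegun1964, 4.1.24] -/
def log1pUpper (E : ℚ) : ℚ :=
  if 2 / 3 ≤ E then
    log2Hi - ((1 - min E 1) / 2 + ((1 - min E 1) / 2) ^ 2 / 2 + ((1 - min E 1) / 2) ^ 3 / 3 +
      ((1 - min E 1) / 2) ^ 4 / 4 + ((1 - min E 1) / 2) ^ 5 / 5)
  else if 1 / 5 < E then logAlt E 21 else logAlt E 9

/-- Cast of `logAlt` to the real alternating sum. [cite: AbramowitzStegun1964, 4.1.24] -/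
theorem cast_logAlt (E : ℚ) (n : ℕ) :
    ((logAlt E n : ℚ) : ℝ) = ∑ i ∈ Finset.range n, (-1) ^ i * (E : ℝ) ^ (i + 1) / (i + 1) := by
  rw [logAlt, logAltAux_eq]
  push_cast
  rfl

/-- **Soundness of `log1pUpper`**: `0 ≤ e ≤ 1`, `e ≤ E` ⟹ `log (1 + e) ≤ log1pUpper E`. [cite: AbramowitzStegun1964, 4.1.24] -/
theorem log_one_add_le_log1pUpper {e : ℝ} {E : ℚ} (he0 : 0 ≤ e) (he1 : e ≤ 1) (heE : e ≤ E) :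
    Real.log (1 + e) ≤ ((log1pUpper E : ℚ) : ℝ) := by
  have hmono : ∀ {a : ℝ}, e ≤ a → Real.log (1 + e) ≤ Real.log (1 + a) := fun h =>
    Real.log_le_log (by linarith) (by linarith)
  unfold log1pUpper
  by_cases h23 : 2 / 3 ≤ E
  · rw [if_pos h23]
    set E' : ℚ := min E 1 with hE'
    have heE' : e ≤ (E' : ℝ) := by
      rw [hE']; push_cast; exact le_min heE (by simpa using he1)
    have hE'1 : E' ≤ 1 := min_le_right _ _
    have hE'23 : 2 / 3 ≤ E' := le_min h23 (by norm_num)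
    set y : ℝ := (1 - (E' : ℝ)) / 2 with hy
    have hE'1r : ((E' : ℚ) : ℝ) ≤ 1 := by
      have h' : ((E' : ℚ) : ℝ) ≤ ((1 : ℚ) : ℝ) := Rat.cast_le.mpr hE'1
      simpa using h'
    have hE'23r : (2 / 3 : ℝ) ≤ ((E' : ℚ) : ℝ) := by
      have h' : (((2 / 3 : ℚ)) : ℝ) ≤ ((E' : ℚ) : ℝ) := Rat.cast_le.mpr hE'23
      push_cast at h'
      exact h'
    have hy0 : 0 ≤ y := by rw [hy]; linarith
    have hy1 : y < 1 := by rw [hy]; linarith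
    have hsplit : Real.log (1 + (E' : ℝ)) = Real.log 2 + Real.log (1 - y) := by
      rw [← Real.log_mul (by norm_num) (by linarith), hy]; ring_nf
    have hl2 := Real.log_two_lt_d9
    have hp := log_one_sub_le_poly5 hy0 hy1
    refine (hmono heE').trans ?_
    rw [hsplit]
    push_cast [log2Hi]
    rw [hy] at hp ⊢
    norm_num at hl2 hp ⊢
    linarith
  · rw [if_neg h23]
    have hE0 : (0 : ℝ) ≤ E := he0.trans heE
    by_cases h5 : 1 / 5 < E
    · rw [if_pos h5, cast_logAlt]
      exact (hmono heE).trans (log_one_add_le_altSum hE0 10)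
    · rw [if_neg h5, cast_logAlt]
      exact (hmono heE).trans (log_one_add_le_altSum hE0 4)

end KernelQuadrature

end Literature.Analysis.Quadrature
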